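import Literature.Probability.RandomPlanarGeometry.SAWEndpointRateLower
import HarnessLib

/-!
# Kesten's ratio rate, UPPER side with exponent `1/3`, from submultiplicativity at a short length (abstract lemma)

Topic `Literature/Probability/RandomPlanarGeometry` (continues `SAWRatioLimit.lean`: Kesten's forward iteration
`Zd.kesten_iter_forward`, `Zd.kesten_prod_ge`; companion of `SAWEndpointRateUpper.lean` (exponent `1/4` from long-length
envelopes) and `SAWEndpointRateLowerInsertion.lean` (lower side, exponent `1/3`, insertion form)).

Source: N. Madras, G. Slade, *The Self-Avoiding Walk* (1993), §7.5 Notes, eq. (7.5.1) (Kesten 1963): for ALL walks,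
`|c_{N+2}/c_N − μ²| ≤ K N^{-1/3}`.  The upper side with the exponent `1/3` rests on SUBMULTIPLICATIVITY `c_{N+2M} ≤ c_N c_{2M}`
and the Hammersley–Welsh bound at the SHORT length `2M`: if `φ_N ≥ μ² + u` then forward iteration of (7.3.3) gives
`(μ² + u/2)^M c_N ≤ c_{N+2M} ≤ c_N c_{2M} ≤ c_N · A e^{c√M} μ^{2M}`, so `M u ≲ √M`, whence `u ≲ N^{-1/3}` with `M ≍ uN`.  This file
proves the corresponding ABSTRACT lemma on a positive sequence.

## What is here (namespace `Literature.Probability.RandomPlanarGeometry.SAW.Zd.KestenRateUpper`)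

* **`upper_rate_cubeRoot_sub`** — the abstract upper `1/3`-rate lemma, submultiplicative form.
-/

noncomputable section

open Filter Topology Finset

namespace Literature.Probability.RandomPlanarGeometry.SAW.Zd

namespace KestenRateUpper

/-! ### Elementary real lemmas -/

/-- `x ≤ K` from `x² ≤ K`, `K ≥ 1`, `x ≥ 0`. [folklore] -/
private theorem le_of_sq_le {x K : ℝ} (hx : 0 ≤ x) (hK : 1 ≤ K) (h : x ^ 2 ≤ K) : x ≤ K := by
  by_contra hc
  push Not at hc
  have : K * K < x * x := mul_lt_mul'' hc hc (by linarith) (by linarith)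
  nlinarith

/-- `x ≤ K` from `x³ ≤ K`, `K ≥ 1`, `x ≥ 0`. [folklore] -/
private theorem le_of_cube_le {x K : ℝ} (hx : 0 ≤ x) (hK : 1 ≤ K) (h : x ^ 3 ≤ K) : x ≤ K := by
  by_contra hc
  push Not at hc
  have h1 : 1 < x := by linarith
  have : K < x ^ 3 := by nlinarith [mul_lt_mul'' hc hc (by linarith) (by linarith)]
  linarith

/-- `log x ≤ 3 x^{1/3}` for `x > 0`. [folklore] -/
private theorem log_le_three_rpow_third {x : ℝ} (hx : 0 < x) : Real.log x ≤ 3 * x ^ ((1 : ℝ) / 3) := by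
  have h := Real.log_le_sub_one_of_pos (Real.rpow_pos_of_pos hx ((1 : ℝ) / 3))
  rw [Real.log_rpow hx] at h
  linarith

/-- The cube root: `t = N^{1/3}` satisfies `t³ = N`, `t ≥ 1` for `N ≥ 1`, and `N^{-1/3} = t⁻¹`. [folklore] -/
private theorem cubeRoot_facts {N : ℝ} (hN : 1 ≤ N) :
    0 < N ^ ((1 : ℝ) / 3) ∧ 1 ≤ N ^ ((1 : ℝ) / 3) ∧ (N ^ ((1 : ℝ) / 3)) ^ 3 = N ∧
      N ^ (-(1 : ℝ) / 3) = (N ^ ((1 : ℝ) / 3))⁻¹ := by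
  have hN0 : 0 < N := by linarith
  refine ⟨Real.rpow_pos_of_pos hN0 _, Real.one_le_rpow hN (by norm_num), ?_, ?_⟩
  · rw [← Real.rpow_natCast, ← Real.rpow_mul hN0.le]; norm_num
  · rw [show (-(1 : ℝ) / 3) = -((1 : ℝ) / 3) by ring, Real.rpow_neg hN0.le]

/-- `(5N)^{1/3} ≤ 2 N^{1/3}`. [folklore] -/
private theorem rpow_third_five_mul_le {N : ℝ} (hN : 0 ≤ N) : (5 * N) ^ ((1 : ℝ) / 3) ≤ 2 * N ^ ((1 : ℝ) / 3) := by
  rw [Real.mul_rpow (by norm_num) hN]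
  apply mul_le_mul_of_nonneg_right _ (Real.rpow_nonneg hN _)
  have : (5 : ℝ) ^ ((1 : ℝ) / 3) ≤ (8 : ℝ) ^ ((1 : ℝ) / 3) := Real.rpow_le_rpow (by norm_num) (by norm_num) (by norm_num)
  refine this.trans (le_of_eq ?_)
  rw [show (8 : ℝ) = 2 ^ (3 : ℕ) by norm_num, ← Real.rpow_natCast, ← Real.rpow_mul (by norm_num)]; norm_num

/-- Algebra: `μ² − u/2 = μ² (1 − u/(2μ²))`. [folklore] -/
private theorem aux_q (μ u : ℝ) (hμ : 0 < μ) : μ ^ 2 - u / 2 = μ ^ 2 * (1 - u / (2 * μ ^ 2)) := by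
  field_simp

/-- Algebra. [folklore] -/
private theorem aux_A (u N B μ : ℝ) (hB : 0 < B) (hμ : 0 < μ) :
    u * N / (8 * B) * (u / (2 * μ ^ 2)) = u ^ 2 * N / (16 * B * μ ^ 2) := by
  field_simp
  ring

/-- Algebra. [folklore] -/
private theorem aux_B (u N B μ : ℝ) (hB : 0 < B) (hμ : 0 < μ) :
    u * N / (8 * B) * (u / (2 * μ ^ 2)) ^ 2 = u ^ 3 * N / (32 * B * μ ^ 4) := by
  field_simp
  ring

/-- Algebra. [folklore] -/
private theorem aux_y (u N B : ℝ) (hB : 0 < B) : u * N / (4 * B) / 2 = u * N / (8 * B) := by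
  field_simp
  ring



/-- `log(1+x) ≥ x/2` on `[0,1]`. [folklore] -/
private theorem half_le_log_one_add'' {x : ℝ} (hx0 : 0 ≤ x) (hx1 : x ≤ 1) : x / 2 ≤ Real.log (1 + x) := by
  have h := Real.one_sub_inv_le_log_of_pos (show 0 < 1 + x by linarith)
  have h2 : x / 2 ≤ 1 - (1 + x)⁻¹ := by
    have e : 1 - (1 + x)⁻¹ = x / (1 + x) := by field_simp; ring
    rw [e]
    exact div_le_div_of_nonneg_left hx0 (by linarith) (by linarith)
  linarith

/-- `log(1+x) ≥ 1/2` for `x ≥ 1`. [folklore] -/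
private theorem half_le_log_one_add_of_one_le {x : ℝ} (hx1 : 1 ≤ x) : (1 : ℝ) / 2 ≤ Real.log (1 + x) := by
  have h : (1 : ℝ) / 2 ≤ Real.log 2 := by
    have := half_le_log_one_add'' (x := 1) zero_le_one le_rfl
    norm_num at this ⊢
    exact this
  have h2 : Real.log 2 ≤ Real.log (1 + x) := Real.log_le_log (by norm_num) (by linarith)
  linarith

/-! ### The abstract upper `1/3`-rate lemma, submultiplicative form -/

/-- **Upper deviation rate `N^{-1/3}` from submultiplicativity at a short length.** For a positive sequence `a` with Kesten's
inequality (7.3.3) (constant `B ≥ 1`, all `n ≥ 1`), a second sequence `a₂` with `a_{N+2M} ≤ a_N · a₂(M)` and the short-length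
envelope `a₂(M) ≤ A e^{c√M} μ^{2M}` (`μ, A ≥ 1`): there is `K` with `u ≤ K N^{-1/3}` whenever `N ≥ 1`, `u > 0`,
`μ² + u ≤ a_{N+2}/a_N`. [cite: MadrasSlade1993, §7.5, eq. (7.5.1) (Kesten 1963: the exponent 1/3); Lemma 7.3.1; eq. (1.2.3) (submultiplicativity)] -/
theorem upper_rate_cubeRoot_sub {a a₂ : ℕ → ℝ} {μ B c A : ℝ} (ha : ∀ n, 0 < a n) (hμ : 1 ≤ μ)
    (hB1 : 1 ≤ B) (hA : 1 ≤ A)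
    (hK : ∀ n : ℕ, 1 ≤ n → a (n + 2) / a n - B / n ≤ a (n + 4) / a (n + 2))
    (hsub : ∀ N M : ℕ, a (N + 2 * M) ≤ a N * a₂ M)
    (hhi : ∀ M : ℕ, a₂ M ≤ A * Real.exp (c * Real.sqrt M) * μ ^ (2 * M)) :
    ∃ K : ℝ, ∀ N : ℕ, 1 ≤ N → ∀ u : ℝ, 0 < u → μ ^ 2 + u ≤ a (N + 2) / a N →
      u ≤ K * (N : ℝ) ^ (-(1 : ℝ) / 3) := by
  have hμ0 : 0 < μ := by linarith
  have hB0 : 0 < B := by linarith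
  have hA0 : 0 < A := by linarith
  set R : ℝ := Real.log A with hR
  have hR0 : 0 ≤ R := Real.log_nonneg hA
  -- constants
  set KA : ℝ := 1 + 64 * B * μ ^ 2 * R with hKA
  set KB : ℝ := 1 + 512 * B * μ ^ 4 * c ^ 2 with hKB
  set KL : ℝ := 32 * B * (R + c ^ 2) with hKL
  set K : ℝ := 8 * B + KA + KB + KL with hKdef
  have hKA1 : 1 ≤ KA := by
    have : 0 ≤ 64 * B * μ ^ 2 * R := by positivity
    rw [hKA]; linarith
  have hKB1 : 1 ≤ KB := by
    have : 0 ≤ 512 * B * μ ^ 4 * c ^ 2 := by positivity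
    rw [hKB]; linarith
  have hKL0 : 0 ≤ KL := by rw [hKL]; positivity
  refine ⟨K, fun N hN u hu hdev => ?_⟩
  have hNr : (1 : ℝ) ≤ N := by exact_mod_cast hN
  have hN0 : (0 : ℝ) < N := by linarith
  obtain ⟨ht0, ht1, ht3, htinv⟩ := cubeRoot_facts hNr
  set t : ℝ := (N : ℝ) ^ ((1 : ℝ) / 3) with htdef
  rw [htinv, ← div_eq_mul_inv, le_div_iff₀ ht0]
  have hut0 : 0 ≤ u * t := by positivity
  have ht2 : 1 ≤ t ^ 2 := one_le_pow₀ ht1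
  -- block count `y = uN/(4B)`
  set y : ℝ := u * N / (4 * B) with hy
  have hy0 : 0 ≤ y := by positivity
  have huN : u * t * t ^ 2 = u * N := by rw [← ht3]; ring
  by_cases hsmall : y < 2
  · have h1 : u * N < 8 * B := by
      rw [hy, div_lt_iff₀ (by positivity)] at hsmall; linarith
    have : u * t ≤ 8 * B := by nlinarith
    rw [hKdef]; linarith
  · push Not at hsmall
    set M : ℕ := ⌊y⌋₊ with hMdef
    have hMle : (M : ℝ) ≤ y := Nat.floor_le hy0
    have hM2 : 2 ≤ M := by
      have : (2 : ℝ) ≤ M := by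
        have := Nat.le_floor (show ((2 : ℕ) : ℝ) ≤ y by exact_mod_cast hsmall)
        exact_mod_cast this
      exact_mod_cast this
    have hMr2 : (2 : ℝ) ≤ M := by exact_mod_cast hM2
    have hM0 : (0 : ℝ) < M := by linarith
    have hMlt : y < M + 1 := Nat.lt_floor_add_one y
    have hMy : y / 2 ≤ M := by linarith
    -- `M B ≤ u N / 2` and `u N ≤ 8 B M`
    have huN0 : 0 ≤ u * N := by positivity
    have hMB : (M : ℝ) * B ≤ u * N / 2 := by
      have h1 : (M : ℝ) * (4 * B) ≤ u * N := (le_div_iff₀ (by positivity)).1 hMle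
      linarith
    have huNM : u * N ≤ 8 * B * M := by
      have h1 : u * N < ((M : ℝ) + 1) * (4 * B) := (div_lt_iff₀ (by positivity)).1 hMlt
      have h2 : B ≤ (M : ℝ) * B := le_mul_of_one_le_left hB0.le (by linarith)
      nlinarith
    -- forward product: `q^M a N ≤ a (N + 2M) ≤ a N * a₂ M`
    set q : ℝ := μ ^ 2 + u / 2 with hq
    have hq0 : 0 ≤ q := by positivity
    have hK' : ∀ n : ℕ, 1 ≤ n → (fun n => a (n + 2) / a n) n - B / n ≤ (fun n => a (n + 2) / a n) (n + 2) := by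
      intro n hn; simpa [add_assoc] using hK n hn
    have hiter := kesten_iter_forward (φ := fun n => a (n + 2) / a n) (N₁ := 1) hB0.le hK' hN hN
    have hstep : ∀ k < M, q ≤ a (N + 2 * k + 2) / a (N + 2 * k) := by
      intro k hk
      have h1 := hiter k
      have h2 : (k : ℝ) * B / N ≤ u / 2 := by
        rw [div_le_iff₀ hN0]
        have : (k : ℝ) * B ≤ M * B := mul_le_mul_of_nonneg_right (by exact_mod_cast hk.le) hB0.le
        linarith
      have e : a (N + 2 * k + 2) / a (N + 2 * k) = (fun n => a (n + 2) / a n) (N + 2 * k) := rfl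
      rw [e]
      linarith
    have hprod := kesten_prod_ge ha (n := N) (M := M) hq0 hstep
    have hqM : q ^ M ≤ A * Real.exp (c * Real.sqrt M) * μ ^ (2 * M) := by
      have h1 : q ^ M * a N ≤ a₂ M * a N := by rw [mul_comm (a₂ M)]; exact hprod.trans (hsub N M)
      exact (le_of_mul_le_mul_right h1 (ha N)).trans (hhi M)
    -- logs: `M log(1 + x) ≤ R + c√M`, `x = u/(2μ²)`
    set x : ℝ := u / (2 * μ ^ 2) with hx
    have hx0 : 0 < x := by positivity
    have hqx : q = μ ^ 2 * (1 + x) := by rw [hq, hx]; field_simp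
    have hlog1 : (M : ℝ) * Real.log (1 + x) ≤ R + c * Real.sqrt M := by
      have hpos1 : 0 < q ^ M := pow_pos (by positivity) M
      have h := Real.log_le_log hpos1 hqM
      have e1 : Real.log (q ^ M) = (M : ℝ) * (2 * Real.log μ + Real.log (1 + x)) := by
        rw [Real.log_pow, hqx, Real.log_mul (by positivity) (by positivity), Real.log_pow]; push_cast; ring
      have e2 : Real.log (A * Real.exp (c * Real.sqrt M) * μ ^ (2 * M)) = R + c * Real.sqrt M + (2 * (M : ℝ)) * Real.log μ := by
        rw [Real.log_mul (by positivity) (by positivity), Real.log_mul (by positivity) (by positivity), Real.log_exp,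
          Real.log_pow]; push_cast; ring
      rw [e1, e2] at h
      have e3 : (M : ℝ) * (2 * Real.log μ + Real.log (1 + x)) = 2 * (M : ℝ) * Real.log μ + (M : ℝ) * Real.log (1 + x) := by
        ring
      rw [e3] at h
      linarith
    rcases le_or_gt x 1 with hx1 | hx1
    · -- `x ≤ 1`: `M x ≤ 2R + 2c√M`
      have hmain : (M : ℝ) * x ≤ 2 * R + 2 * c * Real.sqrt M := by
        have := mul_le_mul_of_nonneg_left (half_le_log_one_add'' hx0.le hx1) hM0.le
        linarith
      rcases le_or_gt ((M : ℝ) * x) (4 * R) with hA' | hB'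
      · -- (A): `u² N ≤ 64 B μ² R`
        have h2 : u * N / (8 * B) * x ≤ 4 * R :=
          le_trans (mul_le_mul_of_nonneg_right (by rw [← aux_y u N B hB0]; exact hMy) hx0.le) hA'
        have h3 : u ^ 2 * N ≤ 64 * B * μ ^ 2 * R := by
          rw [hx, aux_A u N B μ hB0 hμ0, div_le_iff₀ (by positivity)] at h2
          linarith
        have h5 : (u * t) ^ 2 ≤ KA := by
          have e : u ^ 2 * N = (u * t) ^ 2 * t := by rw [← ht3]; ring
          rw [e] at h3
          have h4 : (u * t) ^ 2 * 1 ≤ (u * t) ^ 2 * t := mul_le_mul_of_nonneg_left ht1 (sq_nonneg _)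
          rw [hKA]; linarith
        have := le_of_sq_le hut0 hKA1 h5
        rw [hKdef]; linarith
      · -- (B): `M x ≤ 4 c √M`, so `M x² ≤ 16 c²` and `u³ N ≤ 512 B μ⁴ c²`
        have h1 : (M : ℝ) * x ≤ 4 * c * Real.sqrt M := by linarith
        have hsM : Real.sqrt (M : ℝ) ^ 2 = M := Real.sq_sqrt hM0.le
        have h2 : (M : ℝ) * x ^ 2 ≤ 16 * c ^ 2 := by
          have hl : 0 ≤ (M : ℝ) * x := by positivity
          have h3 : ((M : ℝ) * x) ^ 2 ≤ (4 * c * Real.sqrt M) ^ 2 := pow_le_pow_left₀ hl h1 2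
          have e : (4 * c * Real.sqrt (M : ℝ)) ^ 2 = 16 * c ^ 2 * M := by rw [mul_pow, mul_pow, hsM]; ring
          rw [e] at h3
          have e2 : ((M : ℝ) * x) ^ 2 = (M : ℝ) * ((M : ℝ) * x ^ 2) := by ring
          rw [e2] at h3
          have h4 : (M : ℝ) * ((M : ℝ) * x ^ 2) ≤ (M : ℝ) * (16 * c ^ 2) := by linarith
          exact le_of_mul_le_mul_left h4 hM0
        have h3 : u ^ 3 * N ≤ 512 * B * μ ^ 4 * c ^ 2 := by
          have h4 : u * N / (8 * B) * x ^ 2 ≤ 16 * c ^ 2 :=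
            le_trans (mul_le_mul_of_nonneg_right (by rw [← aux_y u N B hB0]; exact hMy) (by positivity)) h2
          rw [hx, aux_B u N B μ hB0 hμ0, div_le_iff₀ (by positivity)] at h4
          linarith
        have h5 : (u * t) ^ 3 ≤ KB := by
          have e : u ^ 3 * N = (u * t) ^ 3 := by rw [← ht3]; ring
          rw [e] at h3; rw [hKB]; linarith
        have := le_of_cube_le hut0 hKB1 h5
        rw [hKdef]; linarith
    · -- large deviation `x > 1`: `log(1+x) ≥ 1/2`, so `M ≤ 2R + 2c√M ≤ 4R + 4c²`, and `u N ≤ 8 B M`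
      have h1 : (M : ℝ) ≤ 2 * R + 2 * c * Real.sqrt M := by
        have := mul_le_mul_of_nonneg_left (half_le_log_one_add_of_one_le hx1.le) hM0.le
        linarith
      have hsM : Real.sqrt (M : ℝ) ^ 2 = M := Real.sq_sqrt hM0.le
      have h2 : (M : ℝ) ≤ 4 * R + 4 * c ^ 2 := by
        -- `2c√M ≤ 2c² + M/2`
        have hsq := sq_nonneg (Real.sqrt (M : ℝ) - 2 * c)
        have e : (Real.sqrt (M : ℝ) - 2 * c) ^ 2 = Real.sqrt (M : ℝ) ^ 2 - 4 * c * Real.sqrt M + 4 * c ^ 2 := by ring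
        rw [e, hsM] at hsq
        linarith
      have h3 : u * N ≤ KL := by
        rw [hKL]
        calc u * N ≤ 8 * B * M := huNM
          _ ≤ 8 * B * (4 * R + 4 * c ^ 2) := mul_le_mul_of_nonneg_left h2 (by positivity)
          _ = 32 * B * (R + c ^ 2) := by ring
      have h4 : u * t ≤ KL := by
        have : u * t * 1 ≤ u * t * t ^ 2 := mul_le_mul_of_nonneg_left ht2 hut0
        rw [huN] at this; linarith
      rw [hKdef]; linarith

end KestenRateUpper

end Literature.Probability.RandomPlanarGeometry.SAW.Zd
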